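/-
Copyright: public-domain mathematics; typed transcription for the H21 Literature library (cell lit-balaban,
reader/typer seat r02 gen 5 = literature-prover-lit-balaban-r02-g5-0).

statement-level skeleton of published theorems with citation tags; proofs where landed; nothing here is a claim about the Yang–Mills mass gap

# Bałaban, *Propagators and renormalization transformations for lattice gauge theories. I*,
# Commun. Math. Phys. **95** (1984) 17–40 — Proposition 1.2 (1.110), FIRST ENTRY `|(GJ)(x)| ≤ O(1)e^{−δ₀|y−y′|}|J|`,
# PROVED for the setting of record `B5Prop12FieldsLattice.latticeSettingP12 n M 1 k` (G = Δ₁⁻¹, U = 1, every torus)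

[cite: Balaban1984PropagatorsI]  T. Bałaban, Commun. Math. Phys. 95 (1984) 17–40, Proposition 1.2 (1.110) p. 35
[PDF 19]: *"There exists a positive constant δ₀ depending on d only, such that |(GJ)(x)|, |(∇GJ)(x)|, |(G∇*J)(x)|,
|(ΔGJ)(x)| ≤ O(1)e^{−δ₀|y−y′|}|J| (1.110) for x ∈ Δ̃(y), supp J ⊂ Δ̃(y′), with the constant O(1) depending on d
only"*; p. 34: *"(for a = 1)"*; (1.71) p. 30 `G = Δ_a⁻¹` («Δ_a⁻¹ = G_k, or simply G. (1.71)», p. 30 [PDF 14] L6;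
v1.2: v1.0/v1.1 wrote "p. 31" — p37 gen 9 CITELOC-SWEEP-B5 §2a, QUOTE-AUDIT-B5 item B7); the cubes `Δ̃(y)` and the
norm `|J|` (1.108) p. 35.  PDF held: `paper:balaban1984-cmp95-propagators-rt-i` (journal page = PDF page + 16),
pp. 30, 34–36 read.  (v1.2 is DOCSTRING-ONLY: this locator + two cell-word guillemets de-guillemeted; guillemets in this
file = verbatim print only; declarations byte-identical.)

CITATION HEADER / WHAT IS REPRODUCED.  Cell `lit-balaban` (HOME `run/shared/lean/pub/lit-balaban/`), SKELETON row
**B5.Prop1.2** (decl of record `B5.Prop12Printed`, its body `B5.Ineq110_114`; fold owner r02 = this seat; referee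
ref-4).  The Prop-1.2 half of the torus carrier was fixed by this seat as the concrete object
`B5Prop12FieldsLattice.prop12FieldsLattice n M a` / `latticeSettingP12 n M a k` (p254249): its first (1.110) entry is
`(latticeSettingP12 n M a k).e 0 (.vec J) y = sup_{(x,μ) ∈ Δ̃(y) × dirs} |((Δ_a)⁻¹J)_μ(x)|` (`eL`), with `Δ̃(y) =
cubeT n M y`, `|y − y′| = distSite M y y′` (sup torus distance on the unit lattice `Tor M`), `|J| = supNormL`.
THIS FILE PROVES that entry's printed bound AT `a = 1`, for EVERY fine torus `Tor (fine n M)` (`n = L^k ≥ 1`, periods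
`M`, dimension `d + 1 ≥ 1`), with `δ₀ = delta110 d > 0` and `O(1) = C110 d` FUNCTIONS OF `d` ALONE:

  `ineq110_first_latticeSettingP12 : (latticeSettingP12 n M 1 k).suppIn J y′ →
      (latticeSettingP12 n M 1 k).e 0 J y ≤ C110 d · exp(−δ₀·(latticeSettingP12 n M 1 k).dist y y′) · (latticeSettingP12 n M 1 k).supNorm J`

— literally the `n = 0` instance of the first conjunct of `B5.Ineq110_114 (latticeSettingP12 n M 1 k) (C110 d) … (delta110 d)`.

ROUTE (ours; the paper proves Prop. 1.2 by the random-walk expansion (1.117)–(1.134)).  The analytic input is the tree's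
exponentially WEIGHTED ROW-SUM bound for Bałaban's propagator `G = Δ₁⁻¹` on the torus,
`B5G110BlockRowSum.weighted_row_sum_le'` (PV15 lineage; from the kernel decay `B5G183FreeRowSum` /
`B5G183KernelDecay`, i.e. from (1.83)-type Fourier analysis of `Δ₁⁻¹`, uniform in `n` and in the torus):
`Σ_j e^{δ′|blockOf x − blockOf j|} |G((x,μ),j)| ≤ C_w(d, δ′)` for `δ′ < min(1/(2(d+1)), κ₁₈₃/(d+1))`.  We take
`δ₀ := ½·min(…)`, and the plumbing of §2 identifies the row's vocabulary with the printed one: the doubled cube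
`Δ̃(y)` lies in the blocks `B(ỹ)` with `|ỹ − y| ≤ 1` (`torusSupNorm_blockOf_sub_le_one`), `distSite = torusSupNorm ∘ rep`
(`distSite_eq_torusSupNorm`), so `|y − y′| ≤ 2 + |blockOf x − blockOf x′|` for `x ∈ Δ̃(y)`, `x′ ∈ Δ̃(y′)`, whence
`|(GJ)_μ(x)| ≤ Σ_j |G((x,μ),j)||J(j)| ≤ e^{2δ₀}C_w · e^{−δ₀|y−y′|} · |J|` (`norm_inv_DeltaA_mulVec_le`).

NEAREST TREE NEIGHBOUR.  `B5Prop12Entries110.entry110G_one` (G-an2-4 leaf 01) proves the same first entry in the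
`B5G183FreeRowSum` currency — UNIT cubes `B(y)`, `B(y′)` on both sides, block points `bpt`, distance `torusSupNorm` — and
its header records that the passage to the printed DOUBLED cubes `Δ̃` "is not typed" (that header's words).  This file makes that passage
(by the weighted row sum rather than by splitting `J` over the `2^{d+1}` unit cubes of `Δ̃(y′)`) and lands the entry
in the vocabulary of the carrier of record (`cubeT`/`cubeB`, `distSite`, `supNormL`, `suppInL`, `eL`), i.e. as a
statement about the fields of `B5.Setting` that `B5.Prop12Printed` quantifies over.

HONEST SCOPE.  (i) the FIRST of the four sup entries of (1.110) only (no `∇G`, `G∇*`, `ΔG`; nothing of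
(1.111)–(1.114)); (ii) `a = 1` (the paper's own normalisation p. 34 «(for a = 1)»; the tree's kernel bounds
`B5G183*` are at `a = 1`), `U = 1` (B5 is the `U = 1` paper); (iii) constants ours and crude (`C110`, `delta110`),
depending on `d` only as printed, NOT Bałaban's; (iv) §1 also discharges the sign package `B5FromB4.ModelSigns` of the
chain of record for the same carrier (every `a`, general `d`).  value = one printed entry of Prop. 1.2 for the
concrete torus objects + one structural hypothesis of the chain — NOT summit progress.

v1.1 (append-only, §5): the GLOBAL first entry (1.115) «|GJ| ≤ O(1)|J|» p. 36 for the same setting —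
`ineq115_first_latticeSettingP12 : (latticeSettingP12 n M 1 k).e 0 J y ≤ C115 d · (latticeSettingP12 n M 1 k).supNorm J`
for EVERY `y` (no support hypothesis on `J`), i.e. the index-0 instance of the first conjunct of
`B5.Global115_117 (latticeSettingP12 n M 1 k) g (C115 d) …`; from PV15's global bound
`B5G115SupBound.norm_DeltaA_one_inv_mulVec_le_global` by name (`C115 d` = its constant at `N = d`, a function of `d`
alone).  Same honest scope (first sup entry, `a = 1`, constants ours).
-/
import Mathlib
import Literature.MathematicalPhysics.QuantumFieldTheory.Balaban1983to89.B5Prop12FieldsLattice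
import Literature.MathematicalPhysics.QuantumFieldTheory.Balaban1983to89.B5G110BlockRowSum
import Literature.MathematicalPhysics.QuantumFieldTheory.Balaban1983to89.B5FromB4
import Literature.MathematicalPhysics.QuantumFieldTheory.Balaban1983to89.T4EtaRateOperatorTorus

open scoped BigOperators Matrix Real
open Finset Complex Matrix

namespace Literature.MathematicalPhysics.QuantumFieldTheory.Balaban1983to89.B5Ineq110P12Lattice

open Literature.MathematicalPhysics.QuantumFieldTheory.Balaban1983to89
open Literature.MathematicalPhysics.QuantumFieldTheory.Balaban1983to89.B5Prop11Plancherel (Tor fine)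
open Literature.MathematicalPhysics.QuantumFieldTheory.Balaban1983to89.B5Prop11SettingModel
open Literature.MathematicalPhysics.QuantumFieldTheory.Balaban1983to89.B5Prop12FieldsLattice
open Literature.MathematicalPhysics.QuantumFieldTheory.Balaban1983to89.B5DeltaA169 (DeltaA)
open Literature.MathematicalPhysics.QuantumFieldTheory.Balaban1983to89.B4TorusKernel (periodConst)
open Literature.MathematicalPhysics.QuantumFieldTheory.Balaban1983to89.B4TorusKernel.MultiPeriod (torusSupNorm circAbs
  circAbs_nonneg circAbs_le_abs)
open Literature.MathematicalPhysics.QuantumFieldTheory.Balaban1983to89.B5Block118 (bpt)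
open Literature.MathematicalPhysics.QuantumFieldTheory.Balaban1983to89.B5G183Strip (kappa183 kappa183_pos)
open Literature.MathematicalPhysics.QuantumFieldTheory.Balaban1983to89.B5G183CovDecay (MD183 MD183_nonneg)
open Literature.MathematicalPhysics.QuantumFieldTheory.Balaban1983to89.B5Kernel166Decay (periodConst_pos)
open Literature.MathematicalPhysics.QuantumFieldTheory.Balaban1983to89.B6LowerBound2153Torus (toT rep toT_rep)
open Literature.MathematicalPhysics.QuantumFieldTheory.Balaban1983to89.B6Cov2156Torus (one_le_M)
open Literature.MathematicalPhysics.QuantumFieldTheory.Balaban1983to89.B4Sect5Proof (latticeConst latticeConst_nonneg)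
open Literature.MathematicalPhysics.QuantumFieldTheory.Balaban1983to89.B5G183KernelDecay (bpt_toT)
open Literature.MathematicalPhysics.QuantumFieldTheory.Balaban1983to89.B5G183FreeUniform (circAbs_fine_ge)
open Literature.MathematicalPhysics.QuantumFieldTheory.Balaban1983to89.B5G115SupBound (exists_eq_bpt_blockOf
  norm_DeltaA_one_inv_mulVec_le_global)
open Literature.MathematicalPhysics.QuantumFieldTheory.Balaban1983to89.B5G110BlockRowSum (weighted_row_sum_le')
open Literature.MathematicalPhysics.QuantumFieldTheory.Balaban1983to89.T4EtaRateOperatorTorus (torusSupNorm_add_le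
  torusSupNorm_neg)
open Literature.MathematicalPhysics.QuantumFieldTheory.Balaban1983to89.LatticeNorms (supNorm supNorm_le
  norm_le_supNorm supNorm_nonneg)

noncomputable section

variable {d : ℕ}

/-! ## §1 The sign package `B5FromB4.ModelSigns` of the completed carrier (every `a`, general `d`) -/

section Signs

variable (n : ℕ) [NeZero n] (M : Fin d → ℕ) [∀ μ, NeZero (M μ)] (a : ℝ) (k : ℕ)

/-- **`B5FromB4.ModelSigns` of the completed torus carrier, DISCHARGED** (both are sups of non-negative
quantities): the distance of the unit-lattice points and the norms `|J|` (1.108), `‖J‖` (ℓ²), `‖J‖_ε` (1.109),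
`‖ζ‖_α + |ζ|`, `|ζ|` of `latticeSettingP12 n M a k` are all non-negative — the inputs `SgG` (and, for the same
carrier shape, `SgGp`/`SgG0`) of the chain `B5Prop12Chain.prop12_of_B4_walk`, by name.
[cite: Balaban1984PropagatorsI, (1.108)–(1.109) p.35, Prop. 1.2 (1.110)–(1.114) pp.35–36] -/
theorem modelSigns_latticeSettingP12 : B5FromB4.ModelSigns (latticeSettingP12 n M a k) where
  dist_nonneg := fun y y' => distSite_nonneg y y'
  supNorm_nonneg := fun J => supNormL_nonneg J
  l2Norm_nonneg := fun J => locNorm_nonneg J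
  holder_nonneg := fun ε J => holderL_nonneg ε J
  cutH_nonneg := fun α ζ => cutHL_nonneg α ζ
  cutSup_nonneg := fun ζ => cutSupL_nonneg ζ

/-- the same for a family of tori `i ↦ latticeSettingP12 (n i) (M i) (a i) (k i)` (the shape in which the chain
consumes it: `∀ i, ModelSigns (fam i)`). [cite: Balaban1984PropagatorsI, Prop. 1.2 (1.110)–(1.114) pp.35–36] -/
theorem modelSigns_family {I : Type} (k : I → ℕ) (n : I → ℕ) [∀ i, NeZero (n i)] (M : I → Fin d → ℕ)
    [∀ i μ, NeZero (M i μ)] (a : I → ℝ) :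
    ∀ i, B5FromB4.ModelSigns (latticeSettingP12 (n i) (M i) (a i) (k i)) :=
  fun i => modelSigns_latticeSettingP12 (n i) (M i) (a i) (k i)

end Signs

/-! ## §2 Plumbing: the printed distances and cubes versus the tree's block/torus vocabulary -/

section Metric

/-- the circular distance of two residues, read from integer representatives:
`|(ā − b̄)|_{ℤ/N} = dist(a − b, Nℤ) = circAbs N (a − b)`. [folklore]
[cite: Balaban1984PropagatorsI, Prop. 1.2 (1.110) p.35 (the distance |y − y′| on the torus)] -/
theorem natAbs_valMinAbs_intCast_sub {N : ℕ} [NeZero N] (a b : ℤ) :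
    ((((a : ZMod N) - (b : ZMod N)).valMinAbs.natAbs : ℕ) : ℤ) = circAbs N (a - b) := by
  have hz : ((a : ZMod N) - (b : ZMod N)) = ((a - b : ℤ) : ZMod N) := by push_cast; rfl
  rw [hz, ZMod.valMinAbs_natAbs_eq_min]
  have hv : ((((a - b : ℤ) : ZMod N)).val : ℤ) = (a - b) % (N : ℤ) := ZMod.val_intCast (a - b)
  have hle : (((a - b : ℤ) : ZMod N)).val ≤ N := (ZMod.val_lt _).le
  rw [Nat.cast_min, Nat.cast_sub hle, hv]
  rfl

variable (M : Fin (d + 1) → ℕ) [hM : ∀ μ, NeZero (M μ)]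

/-- coordinatewise: `|(y − y′)_μ|_{ℤ/M_μ} = circAbs M_μ (rep y − rep y′)_μ`. [folklore]
[cite: Balaban1984PropagatorsI, Prop. 1.2 (1.110) p.35 (the distance |y − y′|)] -/
theorem natAbs_valMinAbs_sub_eq_circAbs_rep (y y' : Tor M) (μ : Fin (d + 1)) :
    (((y μ - y' μ).valMinAbs.natAbs : ℕ) : ℤ) = circAbs (M μ) (rep M y μ - rep M y' μ) := by
  have h := natAbs_valMinAbs_intCast_sub (N := M μ) (rep M y μ) (rep M y' μ)
  simp only [rep, Int.cast_natCast, ZMod.natCast_zmod_val] at h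
  exact h

/-- **`|y − y′|` of Prop. 1.2 IS the tree's torus sup-distance of representatives**:
`distSite M y y′ = torusSupNorm M (rep y − rep y′)`. [cite: Balaban1984PropagatorsI, Prop. 1.2 (1.110) p.35] -/
theorem distSite_eq_torusSupNorm (y y' : Tor M) :
    distSite M y y' = torusSupNorm M (rep M y - rep M y') := by
  unfold distSite torusSupNorm
  have e : ∀ μ, (((y μ - y' μ).valMinAbs.natAbs : ℕ) : ℝ)
      = ((circAbs (M μ) ((rep M y - rep M y') μ) : ℤ) : ℝ) := fun μ => by
    rw [Pi.sub_apply, ← natAbs_valMinAbs_sub_eq_circAbs_rep M y y' μ, Int.cast_natCast]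
  apply le_antisymm
  · obtain ⟨μ, -, hμ⟩ := Finset.exists_mem_eq_sup (Finset.univ : Finset (Fin (d + 1))) Finset.univ_nonempty
      (fun μ => ((y μ - y' μ).valMinAbs).natAbs)
    rw [hμ, e μ]
    exact Finset.le_sup' (fun i => ((circAbs (M i) ((rep M y - rep M y') i) : ℤ) : ℝ)) (Finset.mem_univ μ)
  · refine Finset.sup'_le _ _ fun μ _ => ?_
    rw [← e μ]
    exact_mod_cast Finset.le_sup (f := fun μ => ((y μ - y' μ).valMinAbs).natAbs) (Finset.mem_univ μ)

/-- the torus sup-distance is symmetric: `|x − z| = |z − x|` (from `T4EtaRateOperatorTorus.torusSupNorm_neg`). [folklore] -/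
private theorem torusSupNorm_sub_comm_P12 (x z : Fin (d + 1) → ℤ) :
    torusSupNorm M (x - z) = torusSupNorm M (z - x) := by
  rw [← neg_sub, torusSupNorm_neg]

/-- the triangle inequality through an intermediate point (from `T4EtaRateOperatorTorus.torusSupNorm_add_le`). [folklore] -/
private theorem torusSupNorm_sub_le_P12 (x w z : Fin (d + 1) → ℤ) :
    torusSupNorm M (x - z) ≤ torusSupNorm M (x - w) + torusSupNorm M (w - z) := by
  have h := torusSupNorm_add_le M (x - w) (w - z)
  rwa [sub_add_sub_cancel] at h

/-- **THE DOUBLED CUBE `Δ̃(y)` LIES IN THE NEIGHBOURING BLOCKS**: a fine site `x ∈ Δ̃(y)` (within one unit of `n·y` in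
every coordinate) has its block label `ỹ = blockOf x` (`x = n·ỹ + r`, `0 ≤ r_μ < n`) at unit-lattice torus distance
`|ỹ − y| ≤ 1`. [cite: Balaban1984PropagatorsI, p.35 («Δ̃(y) … sums of 2^d unit cubes having the point y as a corner»)] -/
theorem torusSupNorm_blockOf_sub_le_one {n : ℕ} [NeZero n] (hn : 1 ≤ n) {x : Tor (fine n M)} {y : Tor M}
    (hx : x ∈ cubeT n M y) : torusSupNorm M (rep M (B5Blocks16.blockOf n M x) - rep M y) ≤ 1 := by
  obtain ⟨r, hr⟩ := exists_eq_bpt_blockOf n M x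
  rw [cubeT, Finset.mem_filter] at hx
  unfold torusSupNorm
  refine Finset.sup'_le _ _ fun μ _ => ?_
  have hxμ : x μ = (((n : ℤ) * rep M (B5Blocks16.blockOf n M x) μ + ((r μ : ℕ) : ℤ) : ℤ) : ZMod (fine n M μ)) := by
    have h1 : x = bpt n M (toT M (rep M (B5Blocks16.blockOf n M x))) r := by rw [toT_rep]; exact hr
    conv_lhs => rw [h1, bpt_toT]
    rfl
  have hyμ : toFine n M y μ = (((n : ℤ) * rep M y μ : ℤ) : ZMod (fine n M μ)) := by
    simp only [toFine, rep]
    push_cast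
    rfl
  have hc := hx.2 μ
  unfold cdistF at hc
  rw [hxμ, hyμ] at hc
  have hc' : ((((((n : ℤ) * rep M (B5Blocks16.blockOf n M x) μ + ((r μ : ℕ) : ℤ) : ℤ) : ZMod (fine n M μ))
      - ((((n : ℤ) * rep M y μ : ℤ)) : ZMod (fine n M μ))).valMinAbs.natAbs : ℕ) : ℤ) ≤ n := by exact_mod_cast hc
  rw [natAbs_valMinAbs_intCast_sub] at hc'
  have hMμ : 1 ≤ M μ := one_le_M M μ
  have hge := circAbs_fine_ge hMμ hn (rep M (B5Blocks16.blockOf n M x) μ - rep M y μ) (((r μ : ℕ) : ℤ))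
  have harg : (n : ℤ) * (rep M (B5Blocks16.blockOf n M x) μ - rep M y μ) + ((r μ : ℕ) : ℤ)
      = (n : ℤ) * rep M (B5Blocks16.blockOf n M x) μ + ((r μ : ℕ) : ℤ) - (n : ℤ) * rep M y μ := by ring
  rw [harg] at hge
  have hfine : (fine n M μ : ℕ) = n * M μ := rfl
  rw [hfine] at hc'
  have hrabs : |((r μ : ℕ) : ℤ)| ≤ (n : ℤ) - 1 := by
    rw [abs_of_nonneg (by positivity)]
    have := (r μ).isLt
    omega
  have h0 := circAbs_nonneg hMμ (rep M (B5Blocks16.blockOf n M x) μ - rep M y μ)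
  have hle1 : circAbs (M μ) (rep M (B5Blocks16.blockOf n M x) μ - rep M y μ) ≤ 1 := by
    by_contra hcon
    have hcon := not_le.mp hcon
    have h2 : (2 : ℤ) ≤ circAbs (M μ) (rep M (B5Blocks16.blockOf n M x) μ - rep M y μ) := by omega
    have hn0 : (0 : ℤ) ≤ n := by positivity
    nlinarith [mul_le_mul_of_nonneg_left h2 hn0]
  rw [Pi.sub_apply]
  exact_mod_cast hle1

end Metric

/-! ## §3 The constants `δ₀ = delta110 d`, `O(1) = C110 d` (functions of `d` alone) -/

section Consts

/-- **`δ₀(d)`**: half the smaller of the two decay rates of the tree's kernel bounds for `Δ₁⁻¹`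
(`1/(2(d+1))` and `κ₁₈₃(d+1)/(d+1)`). Ours, not Bałaban's. [cite: Balaban1984PropagatorsI, Prop. 1.2 p.35 («a positive constant δ₀ depending on d only»)] -/
def delta110 (d : ℕ) : ℝ := min (1 / (2 * ((d : ℝ) + 1))) (kappa183 (d + 1) / ((d : ℝ) + 1)) / 2

/-- `δ₀ > 0`. [cite: Balaban1984PropagatorsI, Prop. 1.2 p.35] -/
theorem delta110_pos (d : ℕ) : 0 < delta110 d := by
  unfold delta110
  have h1 : (0 : ℝ) < 1 / (2 * ((d : ℝ) + 1)) := by positivity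
  have h2 : (0 : ℝ) < kappa183 (d + 1) / ((d : ℝ) + 1) := div_pos (kappa183_pos _) (by positivity)
  have := lt_min h1 h2
  linarith

/-- `δ₀ < 1/(2(d+1))`. [cite: Balaban1984PropagatorsI, Prop. 1.2 p.35] -/
theorem delta110_lt_half (d : ℕ) : delta110 d < 1 / (2 * ((d : ℝ) + 1)) := by
  unfold delta110
  have h1 : (0 : ℝ) < 1 / (2 * ((d : ℝ) + 1)) := by positivity
  have := min_le_left (1 / (2 * ((d : ℝ) + 1))) (kappa183 (d + 1) / ((d : ℝ) + 1))
  linarith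

/-- `δ₀ < κ₁₈₃(d+1)/(d+1)`. [cite: Balaban1984PropagatorsI, Prop. 1.2 p.35] -/
theorem delta110_lt_kappa (d : ℕ) : delta110 d < kappa183 (d + 1) / ((d : ℝ) + 1) := by
  unfold delta110
  have h2 : (0 : ℝ) < kappa183 (d + 1) / ((d : ℝ) + 1) := div_pos (kappa183_pos _) (by positivity)
  have := min_le_right (1 / (2 * ((d : ℝ) + 1))) (kappa183 (d + 1) / ((d : ℝ) + 1))
  linarith

/-- the weighted row-sum constant of `B5G110BlockRowSum.weighted_row_sum_le'` at `N = d`, `δ′ = δ₀(d)`.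
[cite: Balaban1984PropagatorsI, Prop. 1.2 (1.110) p.35 («the constant O(1) depending on d only»)] -/
def Cw110 (d : ℕ) : ℝ :=
  2 * d * 2 ^ d * Real.exp (1 / (2 * (d + 1))) * latticeConst (d + 1) (1 / (2 * (d + 1)) - delta110 d)
    + (d + 1) * (MD183 (d + 1) d * periodConst (kappa183 (d + 1)) d
        * latticeConst (d + 1) (kappa183 (d + 1) / (d + 1) - delta110 d))

/-- `C_w ≥ 0`. [cite: Balaban1984PropagatorsI, Prop. 1.2 (1.110) p.35] -/
theorem Cw110_nonneg (d : ℕ) : 0 ≤ Cw110 d := by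
  unfold Cw110
  have h1 : 0 ≤ latticeConst (d + 1) (1 / (2 * (d + 1)) - delta110 d) :=
    latticeConst_nonneg _ (sub_nonneg.mpr (delta110_lt_half d).le)
  have h2 : 0 ≤ latticeConst (d + 1) (kappa183 (d + 1) / (d + 1) - delta110 d) :=
    latticeConst_nonneg _ (sub_nonneg.mpr (delta110_lt_kappa d).le)
  have h3 : 0 ≤ MD183 (d + 1) d * periodConst (kappa183 (d + 1)) d :=
    mul_nonneg (MD183_nonneg _ _) (periodConst_pos (kappa183_pos _) _).le
  positivity

/-- **`O(1)(d)`** of our (1.110) first entry: `e^{2δ₀}·C_w`. Ours, not Bałaban's.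
[cite: Balaban1984PropagatorsI, Prop. 1.2 (1.110) p.35 («the constant O(1) depending on d only»)] -/
def C110 (d : ℕ) : ℝ := Real.exp (2 * delta110 d) * Cw110 d

/-- `O(1) ≥ 0`. [cite: Balaban1984PropagatorsI, Prop. 1.2 (1.110) p.35] -/
theorem C110_nonneg (d : ℕ) : 0 ≤ C110 d := mul_nonneg (Real.exp_pos _).le (Cw110_nonneg d)

end Consts

/-! ## §4 The first entry of (1.110) for `G = Δ₁⁻¹` on the torus -/

section Entry

variable (M : Fin (d + 1) → ℕ) [hM : ∀ μ, NeZero (M μ)] (n : ℕ) [NeZero n]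

/-- **(1.110), FIRST ENTRY, POINTWISE**: for `x ∈ Δ̃(y)`, a direction `μ`, and a field `J` supported (bondwise) in
`Δ̃(y′)` with `|J| ≤ B`:  `|(Δ₁⁻¹J)_μ(x)| ≤ C110(d)·e^{−δ₀(d)|y − y′|}·B`, on every torus `T_η`, `η = 1/n`.
[cite: Balaban1984PropagatorsI, Prop. 1.2 (1.110) p.35] -/
theorem norm_inv_DeltaA_mulVec_le (hn : 1 ≤ n) {x : Tor (fine n M)} {y y' : Tor M} (hx : x ∈ cubeT n M y)
    (μ : Fin (d + 1)) (J : Tor (fine n M) × Fin (d + 1) → ℂ) {B : ℝ} (hB : 0 ≤ B) (hJB : ∀ j, ‖J j‖ ≤ B)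
    (hsupp : ∀ j, J j ≠ 0 → j.1 ∈ cubeT n M y') :
    ‖((DeltaA n M 1)⁻¹ *ᵥ J) (x, μ)‖
      ≤ C110 d * Real.exp (-(delta110 d * torusSupNorm M (rep M y - rep M y'))) * B := by
  have hδ0 : 0 < delta110 d := delta110_pos d
  have hrow : ∑ j, Real.exp (delta110 d * torusSupNorm M
        (rep M (B5Blocks16.blockOf n M x) - rep M (B5Blocks16.blockOf n M j.1))) * ‖(DeltaA n M 1)⁻¹ (x, μ) j‖
      ≤ Cw110 d := by
    have h := weighted_row_sum_le' n hn M (Nn := d) le_rfl (delta110_lt_half d) (delta110_lt_kappa d) (x, μ)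
    unfold Cw110
    exact h
  have hbx : torusSupNorm M (rep M (B5Blocks16.blockOf n M x) - rep M y) ≤ 1 :=
    torusSupNorm_blockOf_sub_le_one M hn hx
  -- termwise comparison
  have hterm : ∀ j, Real.exp (delta110 d * torusSupNorm M (rep M y - rep M y')) * (‖(DeltaA n M 1)⁻¹ (x, μ) j‖ * ‖J j‖)
      ≤ Real.exp (2 * delta110 d) * (Real.exp (delta110 d * torusSupNorm M
          (rep M (B5Blocks16.blockOf n M x) - rep M (B5Blocks16.blockOf n M j.1))) * ‖(DeltaA n M 1)⁻¹ (x, μ) j‖) * B := by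
    intro j
    by_cases hj : J j = 0
    · rw [hj, norm_zero, mul_zero, mul_zero]
      positivity
    · have hj1 : torusSupNorm M (rep M (B5Blocks16.blockOf n M j.1) - rep M y') ≤ 1 :=
        torusSupNorm_blockOf_sub_le_one M hn (hsupp j hj)
      have htri : torusSupNorm M (rep M y - rep M y')
          ≤ 2 + torusSupNorm M (rep M (B5Blocks16.blockOf n M x) - rep M (B5Blocks16.blockOf n M j.1)) := by
        have h1 := torusSupNorm_sub_le_P12 M (rep M y) (rep M (B5Blocks16.blockOf n M x)) (rep M y')
        have h2 := torusSupNorm_sub_le_P12 M (rep M (B5Blocks16.blockOf n M x))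
          (rep M (B5Blocks16.blockOf n M j.1)) (rep M y')
        have h3 : torusSupNorm M (rep M y - rep M (B5Blocks16.blockOf n M x)) ≤ 1 := by
          rw [torusSupNorm_sub_comm_P12]; exact hbx
        linarith
      have hexp : Real.exp (delta110 d * torusSupNorm M (rep M y - rep M y'))
          ≤ Real.exp (2 * delta110 d) * Real.exp (delta110 d * torusSupNorm M
              (rep M (B5Blocks16.blockOf n M x) - rep M (B5Blocks16.blockOf n M j.1))) := by
        rw [← Real.exp_add]
        exact Real.exp_le_exp.mpr (by nlinarith)
      calc Real.exp (delta110 d * torusSupNorm M (rep M y - rep M y')) * (‖(DeltaA n M 1)⁻¹ (x, μ) j‖ * ‖J j‖)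
          ≤ (Real.exp (2 * delta110 d) * Real.exp (delta110 d * torusSupNorm M
              (rep M (B5Blocks16.blockOf n M x) - rep M (B5Blocks16.blockOf n M j.1))))
              * (‖(DeltaA n M 1)⁻¹ (x, μ) j‖ * B) :=
            mul_le_mul hexp (mul_le_mul_of_nonneg_left (hJB j) (norm_nonneg _))
              (by positivity) (by positivity)
        _ = _ := by ring
  have hGJ : ‖((DeltaA n M 1)⁻¹ *ᵥ J) (x, μ)‖ ≤ ∑ j, ‖(DeltaA n M 1)⁻¹ (x, μ) j‖ * ‖J j‖ := by
    rw [Matrix.mulVec, dotProduct]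
    exact (norm_sum_le _ _).trans (le_of_eq (Finset.sum_congr rfl fun j _ => norm_mul _ _))
  have hsum : Real.exp (delta110 d * torusSupNorm M (rep M y - rep M y')) * ‖((DeltaA n M 1)⁻¹ *ᵥ J) (x, μ)‖
      ≤ Real.exp (2 * delta110 d) * Cw110 d * B := by
    calc Real.exp (delta110 d * torusSupNorm M (rep M y - rep M y')) * ‖((DeltaA n M 1)⁻¹ *ᵥ J) (x, μ)‖
        ≤ Real.exp (delta110 d * torusSupNorm M (rep M y - rep M y'))
            * ∑ j, ‖(DeltaA n M 1)⁻¹ (x, μ) j‖ * ‖J j‖ :=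
          mul_le_mul_of_nonneg_left hGJ (Real.exp_pos _).le
      _ = ∑ j, Real.exp (delta110 d * torusSupNorm M (rep M y - rep M y')) * (‖(DeltaA n M 1)⁻¹ (x, μ) j‖ * ‖J j‖) := by
          rw [Finset.mul_sum]
      _ ≤ ∑ j, Real.exp (2 * delta110 d) * (Real.exp (delta110 d * torusSupNorm M
            (rep M (B5Blocks16.blockOf n M x) - rep M (B5Blocks16.blockOf n M j.1))) * ‖(DeltaA n M 1)⁻¹ (x, μ) j‖)
            * B := Finset.sum_le_sum fun j _ => hterm j
      _ = Real.exp (2 * delta110 d) * (∑ j, Real.exp (delta110 d * torusSupNorm M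
            (rep M (B5Blocks16.blockOf n M x) - rep M (B5Blocks16.blockOf n M j.1))) * ‖(DeltaA n M 1)⁻¹ (x, μ) j‖)
            * B := by
          rw [Finset.mul_sum, Finset.sum_mul]
      _ ≤ Real.exp (2 * delta110 d) * Cw110 d * B := by
          have := hrow
          gcongr
  have hE : 0 < Real.exp (delta110 d * torusSupNorm M (rep M y - rep M y')) := Real.exp_pos _
  have key : ‖((DeltaA n M 1)⁻¹ *ᵥ J) (x, μ)‖
      ≤ (Real.exp (2 * delta110 d) * Cw110 d * B)
          * (Real.exp (delta110 d * torusSupNorm M (rep M y - rep M y')))⁻¹ := by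
    rw [le_mul_inv_iff₀ hE]
    linarith
  calc ‖((DeltaA n M 1)⁻¹ *ᵥ J) (x, μ)‖
      ≤ (Real.exp (2 * delta110 d) * Cw110 d * B)
          * (Real.exp (delta110 d * torusSupNorm M (rep M y - rep M y')))⁻¹ := key
    _ = C110 d * Real.exp (-(delta110 d * torusSupNorm M (rep M y - rep M y'))) * B := by
          rw [Real.exp_neg, C110]; ring

/-- **(1.110), FIRST ENTRY, AS THE CARRIER'S FIELD**: `sup_{(x,μ) ∈ Δ̃(y)×dirs} |(Δ₁⁻¹J)_μ(x)| ≤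
C110(d)·e^{−δ₀(d)|y−y′|}·|J|` for `supp J ⊂ Δ̃(y′)` (bondwise), `|J|` the sup norm (1.108), `|y − y′| = distSite`.
[cite: Balaban1984PropagatorsI, Prop. 1.2 (1.110) p.35] -/
theorem supNorm_cubeB_inv_DeltaA_mulVec_le (hn : 1 ≤ n) (y y' : Tor M)
    (J : Tor (fine n M) × Fin (d + 1) → ℂ) (hsupp : ∀ j, J j ≠ 0 → j.1 ∈ cubeT n M y') :
    supNorm (cubeB n M y) ((DeltaA n M 1)⁻¹ *ᵥ J)
      ≤ C110 d * Real.exp (-(delta110 d * distSite M y y')) * supNorm Finset.univ J := by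
  have hB := supNorm_nonneg Finset.univ J
  have hC := C110_nonneg d
  refine supNorm_le (by positivity) fun b hb => ?_
  obtain ⟨x, μ⟩ := b
  have hx : x ∈ cubeT n M y := (Finset.mem_product.mp hb).1
  rw [distSite_eq_torusSupNorm]
  exact norm_inv_DeltaA_mulVec_le M n hn hx μ J hB (fun j => norm_le_supNorm J (Finset.mem_univ j)) hsupp

/-- **PROPOSITION 1.2 (1.110), FIRST ENTRY, FOR THE SETTING OF RECORD at `a = 1`**: for every torus
(`n = L^k ≥ 1`, periods `M`), every step label `k`, every located argument `J` with `supp J ⊂ Δ̃(y′)` and every `y`: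
`(latticeSettingP12 n M 1 k).e 0 J y ≤ C110(d)·exp(−δ₀(d)·|y − y′|)·|J|` — the `n = 0` instance of the first
conjunct of `B5.Ineq110_114 (latticeSettingP12 n M 1 k) (C110 d) … (delta110 d)`, constants depending on `d` only.
[cite: Balaban1984PropagatorsI, Prop. 1.2 (1.110) p.35] -/
theorem ineq110_first_latticeSettingP12 (hn : 1 ≤ n) (k : ℕ) (J : (latticeSettingP12 n M 1 k).Loc)
    (y y' : (latticeSettingP12 n M 1 k).Site) (hJ : (latticeSettingP12 n M 1 k).suppIn J y') :
    (latticeSettingP12 n M 1 k).e 0 J y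
      ≤ C110 d * Real.exp (-(delta110 d * (latticeSettingP12 n M 1 k).dist y y'))
          * (latticeSettingP12 n M 1 k).supNorm J := by
  change eL n M 1 0 J y ≤ C110 d * Real.exp (-(delta110 d * distSite M y y')) * supNormL n M J
  have hC := C110_nonneg d
  cases J with
  | vec J => exact supNorm_cubeB_inv_DeltaA_mulVec_le M n hn y y' J hJ
  | ten J =>
      have h0 := supNormL_nonneg (n := n) (M := M) (Loc189.ten J)
      show (0 : ℝ) ≤ _
      positivity
  | ten2 J =>
      have h0 := supNormL_nonneg (n := n) (M := M) (Loc189.ten2 J)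
      show (0 : ℝ) ≤ _
      positivity

/-- the same in the exact binder order of the first conjunct of `B5.Ineq110_114` (index `0`):
`∀ J y y′, suppIn J y′ → e 0 J y ≤ C·e^{−δ₀ dist y y′}·supNorm J`. [cite: Balaban1984PropagatorsI, Prop. 1.2 (1.110) p.35] -/
theorem ineq110_114_first_conjunct_entry0 (hn : 1 ≤ n) (k : ℕ) :
    ∀ (J : (latticeSettingP12 n M 1 k).Loc) (y y' : (latticeSettingP12 n M 1 k).Site),
      (latticeSettingP12 n M 1 k).suppIn J y' →
        (latticeSettingP12 n M 1 k).e 0 J y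
          ≤ C110 d * Real.exp (-(delta110 d * (latticeSettingP12 n M 1 k).dist y y'))
              * (latticeSettingP12 n M 1 k).supNorm J :=
  fun J y y' hJ => ineq110_first_latticeSettingP12 M n hn k J y y' hJ

end Entry

/-! ## §5 (v1.1) The global first entry (1.115) «|GJ| ≤ O(1)|J|» for the setting of record -/

section Global

/-- **`O(1)(d)` of our (1.115) first entry**: the constant of `B5G115SupBound.norm_DeltaA_one_inv_mulVec_le_global` at
`N = d`. Ours, not Bałaban's. [cite: Balaban1984PropagatorsI, (1.115) p.36 («with the same dependence of the constants O(1)»)] -/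
def C115 (d : ℕ) : ℝ :=
  2 * d * 2 ^ d * Real.exp (1 / (2 * (d + 1))) * latticeConst (d + 1) (1 / (2 * (d + 1)))
    + (d + 1) * (MD183 (d + 1) d * periodConst (kappa183 (d + 1)) d
        * latticeConst (d + 1) (kappa183 (d + 1) / (d + 1)))

/-- `O(1) ≥ 0`. [cite: Balaban1984PropagatorsI, (1.115) p.36] -/
theorem C115_nonneg (d : ℕ) : 0 ≤ C115 d := by
  unfold C115
  have h1 : 0 ≤ latticeConst (d + 1) (1 / (2 * ((d : ℝ) + 1))) := latticeConst_nonneg _ (by positivity)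
  have h2 : 0 ≤ latticeConst (d + 1) (kappa183 (d + 1) / ((d : ℝ) + 1)) :=
    latticeConst_nonneg _ (div_pos (kappa183_pos _) (by positivity)).le
  have h3 : 0 ≤ MD183 (d + 1) d * periodConst (kappa183 (d + 1)) d :=
    mul_nonneg (MD183_nonneg _ _) (periodConst_pos (kappa183_pos _) _).le
  positivity

variable (M : Fin (d + 1) → ℕ) [hM : ∀ μ, NeZero (M μ)] (n : ℕ) [NeZero n]

/-- **(1.115), FIRST ENTRY, AS THE CARRIER'S FIELD**: `sup_{(x,μ) ∈ Δ̃(y)×dirs} |(Δ₁⁻¹J)_μ(x)| ≤ C115(d)·|J|` for EVERY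
`J` and every `y` (the `ℓ^∞ → ℓ^∞` bound of `Δ₁⁻¹`, uniform in `n` and in the torus).
[cite: Balaban1984PropagatorsI, (1.115) p.36] -/
theorem supNorm_cubeB_inv_DeltaA_mulVec_le_global (hn : 1 ≤ n) (y : Tor M)
    (J : Tor (fine n M) × Fin (d + 1) → ℂ) :
    supNorm (cubeB n M y) ((DeltaA n M 1)⁻¹ *ᵥ J) ≤ C115 d * supNorm Finset.univ J := by
  have hB := supNorm_nonneg Finset.univ J
  have hC := C115_nonneg d
  refine supNorm_le (by positivity) fun b _ => ?_
  have h := norm_DeltaA_one_inv_mulVec_le_global n hn M (Nn := d) le_rfl J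
    (fun j => norm_le_supNorm J (Finset.mem_univ j)) b
  rw [mul_comm]
  unfold C115
  exact h

/-- **(1.115), FIRST ENTRY, FOR THE SETTING OF RECORD at `a = 1`**: for every torus, every `k`, every located
argument `J` and every `y`: `(latticeSettingP12 n M 1 k).e 0 J y ≤ C115(d)·|J|` — the index-0 instance of the first
conjunct of `B5.Global115_117 (latticeSettingP12 n M 1 k) g (C115 d) …` (any `g`), constant depending on `d` only.
[cite: Balaban1984PropagatorsI, (1.115) p.36] -/
theorem ineq115_first_latticeSettingP12 (hn : 1 ≤ n) (k : ℕ) (J : (latticeSettingP12 n M 1 k).Loc)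
    (y : (latticeSettingP12 n M 1 k).Site) :
    (latticeSettingP12 n M 1 k).e 0 J y ≤ C115 d * (latticeSettingP12 n M 1 k).supNorm J := by
  change eL n M 1 0 J y ≤ C115 d * supNormL n M J
  have hC := C115_nonneg d
  cases J with
  | vec J => exact supNorm_cubeB_inv_DeltaA_mulVec_le_global M n hn y J
  | ten J =>
      have h0 := supNormL_nonneg (n := n) (M := M) (Loc189.ten J)
      show (0 : ℝ) ≤ _
      positivity
  | ten2 J =>
      have h0 := supNormL_nonneg (n := n) (M := M) (Loc189.ten2 J)
      show (0 : ℝ) ≤ _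
      positivity

end Global

end

end Literature.MathematicalPhysics.QuantumFieldTheory.Balaban1983to89.B5Ineq110P12Lattice
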